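import Literature.Analysis.Fourier.BoasKacNonnegLattice
import Mathlib.Algebra.Polynomial.Inductions
import HarnessLib

/-!
# Pointwise bounds for positive definite functions of compact support (Boas–Kac 1945, Theorem 2)

RH-FREE classical harmonic analysis (no zeta function anywhere in this file).

**Theorem** (Boas–Kac 1945, Thm 2; restated and re-proved as Kolountzakis–Révész 2006, Cor. 1 /
Cor. 3 "(Boas–Kac [BK])").  Let `f` be positive definite on `ℝ` (its Fourier transform is pointwise a
nonnegative real) and supported in `[-s, s]`, `s > 0`.  Then for every `x ≠ 0`

  `|f(x)| ≤ f(0) · cos (π / (⌈s/|x|⌉ + 1))`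

(`norm_le_re_apply_zero_mul_cos`).  With `n = ⌈s/|x|⌉` the multiples `kx`, `|k| ≥ n`, lie outside
the open support, so the restriction of `f` to the lattice `xℤ` is a positive definite sequence supported
on `|k| ≤ n - 1`, i.e. the coefficient sequence of a NONNEGATIVE TRIGONOMETRIC POLYNOMIAL of degree
`n - 1` with constant term `f(0)` and first coefficient `f(x)`; the bound is then FEJÉR'S INEQUALITY
(Fejér 1915): a trigonometric polynomial `T(θ) = Σ_{|k| ≤ N} c_k e^{ikθ} ≥ 0` has
`|c_1| ≤ c_0 cos (π/(N+2))` (`norm_coeff_succ_le_re_coeff_mul_cos`), the value `2 cos(π/(N+2))` being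
the largest eigenvalue of the path graph on `N + 1` vertices.  Kolountzakis–Révész's Theorem 2 is
exactly this reduction of the pointwise problem to Fejér's trigonometric extremal problem
`M_n = 2 cos (π/(n+2))` (their display (cosvalue)); Connes–Consani 2021 quote the bound in Remark 3.9 (i)
("Theorem 2 of [BK], typo corrected: ceiling function").

## What is proved, and how (tree assets)

* §1 `sum_two_mul_mul_succ_le`: the path-graph quadratic form
  `Σ_{j<N} 2 u_j u_{j+1} ≤ 2cos(π/(N+2)) Σ_{j≤N} u_j²`, by the weighted AM–GM inequality with the
  Perron weights `S(m) = sin (mπ/(N+2))` (`S(j+2) + S(j) = 2 cos(π/(N+2)) S(j+1)`, `S(0) = S(N+2) = 0`).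
* §1 `norm_coeff_succ_le_re_coeff_mul_cos` (Fejér): in the POLYNOMIAL FORM used by the tree's
  Fejér–Riesz theorem (`FejerRiesz.exists_eq_mul_conjReverse`: `natDegree p ≤ 2N` and
  `conj z ^ N · p(z) ≥ 0` on the unit circle ⇒ `p = q · conjReverse N q`), the coefficients are
  `p_N = Σ |q_j|²` (tree: `LatticeStep.sum_norm_sq_coeff_eq_re_coeff`) and `p_{N+1} = Σ q_{j+1} conj q_j`
  (`coeff_succ_mul_conjReverse_self`), so `|p_{N+1}| ≤ cos(π/(N+2)) Re p_N` by §1; the companion bound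
  for `p_{N-1} = conj p_{N+1}` (`FejerRiesz.conjReverse_eq_self_of_nonneg`).
* §2 Boas–Kac: for `f ∈ C^∞` with `tsupport f ⊆ [-s, s]` and `𝓕 f ≥ 0`, mesh `h > 0`, `n = ⌈s/h⌉₊ = m+1`
  and `a = nh/2`, the TREE's Poisson-summation lemma `BoasKacNonneg.nonneg_conj_pow_mul_eval_samplePoly`
  gives `conj z^{m+1} P(z) ≥ 0` on the circle for the sample polynomial `P = Σ_{j ≤ 2n} f((j-n)h) X^j`;
  its extreme samples `f(±nh)` vanish (`nh ≥ s`), so `Q = P.divX` has `natDegree Q ≤ 2m`,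
  `conj z^m Q(z) = conj z^{m+1} P(z) ≥ 0`, `Q_m = f(0)`, `Q_{m+1} = f(h)`, `Q_{m-1} = f(-h)`, and §1 applies
  at level `m`: `cos(π/(m+2)) = cos(π/(n+1))`.
-- TODO(general form): Boas–Kac state Thm 2 for continuous positive definite `f` (Bochner measures);
-- the tree's Poisson step is for `C_c^∞`, which is the class Connes–Consani 2021 Rem. 3.9 (i) consumes
-- (`Literature.NumberTheory.ConnesConsani2021.rem_3_9_i_of_numericalInput`); the continuous case
-- follows by mollification and is not needed downstream.

## References

* R. P. Boas, M. Kac, *Inequalities for Fourier transforms of positive functions*, Duke Math. J. 12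
  (1945) 189–206, Thm 2 (paywalled original; acquisition request acq-10598). [cite: BoasKac1945, Thm 2]
* M. N. Kolountzakis, Sz. Gy. Révész, *On pointwise estimates of positive definite functions with given
  support*, Canad. J. Math. 58 (2006) 401–418 = arXiv:math/0302193, Thm 2, Cor. 1, Cor. 3 (held; the
  secondary source re-proving Boas–Kac's Thm 2, arXiv p. 5). [cite: KolountzakisRevesz2006, Cor. 1]
* L. Fejér, *Über trigonometrische Polynome*, J. reine angew. Math. 146 (1916) 53–82 (the extremal value
  `M_n = 2cos(π/(n+2))`, quoted by Kolountzakis–Révész as [Fej]). [cite: Fejer1916, §1]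

Nothing in this file bears on the truth of the Riemann hypothesis.
-/

noncomputable section

open Polynomial Filter MeasureTheory Set FourierTransform
open _root_.Complex _root_.Real
open scoped ComplexConjugate ComplexOrder Topology ContDiff

namespace Literature.Analysis.Fourier.BoasKacPointwise

open Literature.Analysis.Fourier.FejerRiesz Literature.Analysis.Fourier.LatticeStep
  Literature.Analysis.Fourier.BoasKacNonneg

/-! ## §1 Fejér's inequality for the first coefficient of a nonnegative trigonometric polynomial -/

/-- Weighted AM–GM: `2ab ≤ t a² + b²/t` for `t > 0`. [folklore] -/
private theorem two_mul_le_weighted {a b t : ℝ} (ht : 0 < t) :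
    2 * (a * b) ≤ t * a ^ 2 + b ^ 2 / t := by
  have ht0 : t ≠ 0 := ht.ne'
  rw [← sub_nonneg]
  have e : t * a ^ 2 + b ^ 2 / t - 2 * (a * b) = (t * a - b) ^ 2 / t := by
    field_simp
    ring
  rw [e]
  positivity

/-- **The path-graph quadratic form** (the computation behind Fejér's value `2cos(π/(N+2))`): for real
`u₀, …, u_N`, `Σ_{j<N} 2 u_j u_{j+1} ≤ 2 cos(π/(N+2)) · Σ_{j≤N} u_j²`.  Proof: AM–GM with the weights
`t_j = S(j+2)/S(j+1)`, `S(m) = sin(mπ/(N+2)) > 0` for `1 ≤ m ≤ N+1`, and the three-term identity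
`S(j+2) + S(j) = 2cos(π/(N+2)) S(j+1)` together with `S(0) = S(N+2) = 0`.
[cite: Fejer1916, §1] -/
theorem sum_two_mul_mul_succ_le (N : ℕ) (u : ℕ → ℝ) :
    ∑ j ∈ Finset.range N, 2 * (u j * u (j + 1)) ≤
      2 * Real.cos (π / (N + 2)) * ∑ j ∈ Finset.range (N + 1), u j ^ 2 := by
  set θ : ℝ := π / (N + 2) with hθ
  set S : ℕ → ℝ := fun m => Real.sin (m * θ) with hS
  have hθpos : 0 < θ := by rw [hθ]; positivity
  have hNθ : ((N : ℝ) + 2) * θ = π := by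
    rw [hθ]; field_simp
  have hSpos : ∀ m : ℕ, 1 ≤ m → m ≤ N + 1 → 0 < S m := by
    intro m hm1 hm2
    simp only [hS]
    apply Real.sin_pos_of_pos_of_lt_pi
    · exact mul_pos (Nat.cast_pos.mpr (by omega)) hθpos
    · have hm2' : (m : ℝ) ≤ (N : ℝ) + 1 := by exact_mod_cast hm2
      calc (m : ℝ) * θ ≤ ((N : ℝ) + 1) * θ := by gcongr
        _ < ((N : ℝ) + 2) * θ := by nlinarith
        _ = π := hNθ
  have hS0 : S 0 = 0 := by simp [hS]
  have hSN2 : S (N + 2) = 0 := by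
    simp only [hS]
    have e : ((N + 2 : ℕ) : ℝ) * θ = π := by push_cast; exact hNθ
    rw [e, Real.sin_pi]
  have hrec : ∀ j : ℕ, S (j + 2) + S j = 2 * Real.cos θ * S (j + 1) := by
    intro j
    simp only [hS]
    have e1 : ((j + 2 : ℕ) : ℝ) * θ = ((j + 1 : ℕ) : ℝ) * θ + θ := by push_cast; ring
    have e2 : ((j : ℕ) : ℝ) * θ = ((j + 1 : ℕ) : ℝ) * θ - θ := by push_cast; ring
    rw [e1, e2, Real.sin_add, Real.sin_sub]
    ring
  -- termwise weighted AM–GM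
  have hterm : ∀ j ∈ Finset.range N,
      2 * (u j * u (j + 1)) ≤
        S (j + 2) / S (j + 1) * u j ^ 2 + S (j + 1) / S (j + 2) * u (j + 1) ^ 2 := by
    intro j hj
    have hjN : j < N := Finset.mem_range.mp hj
    have h1 : 0 < S (j + 1) := hSpos (j + 1) (by omega) (by omega)
    have h2 : 0 < S (j + 2) := hSpos (j + 2) (by omega) (by omega)
    calc 2 * (u j * u (j + 1))
        ≤ S (j + 2) / S (j + 1) * u j ^ 2 + u (j + 1) ^ 2 / (S (j + 2) / S (j + 1)) :=
          two_mul_le_weighted (div_pos h2 h1)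
      _ = S (j + 2) / S (j + 1) * u j ^ 2 + S (j + 1) / S (j + 2) * u (j + 1) ^ 2 := by
          rw [div_div_eq_mul_div]; ring
  calc ∑ j ∈ Finset.range N, 2 * (u j * u (j + 1))
      ≤ ∑ j ∈ Finset.range N,
          (S (j + 2) / S (j + 1) * u j ^ 2 + S (j + 1) / S (j + 2) * u (j + 1) ^ 2) :=
        Finset.sum_le_sum hterm
    _ = ∑ j ∈ Finset.range N, S (j + 2) / S (j + 1) * u j ^ 2 +
          ∑ j ∈ Finset.range N, S (j + 1) / S (j + 2) * u (j + 1) ^ 2 := Finset.sum_add_distrib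
    _ = ∑ j ∈ Finset.range (N + 1), S (j + 2) / S (j + 1) * u j ^ 2 +
          ∑ j ∈ Finset.range (N + 1), S j / S (j + 1) * u j ^ 2 := by
        congr 1
        · rw [Finset.sum_range_succ, hSN2, zero_div, zero_mul, add_zero]
        · rw [Finset.sum_range_succ' (fun j => S j / S (j + 1) * u j ^ 2), hS0, zero_div, zero_mul,
            add_zero]
    _ = ∑ j ∈ Finset.range (N + 1), 2 * Real.cos θ * u j ^ 2 := by
        rw [← Finset.sum_add_distrib]
        refine Finset.sum_congr rfl fun j hj => ?_
        have hj' : j < N + 1 := Finset.mem_range.mp hj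
        have h1 : S (j + 1) ≠ 0 := (hSpos (j + 1) (by omega) (by omega)).ne'
        rw [← add_mul, ← add_div, hrec j, mul_div_assoc, div_self h1, mul_one]
    _ = 2 * Real.cos θ * ∑ j ∈ Finset.range (N + 1), u j ^ 2 := by rw [Finset.mul_sum]

/-- The coefficient of `X^{N+1}` in the autocorrelation polynomial: for `natDegree q ≤ N`,
`(q · conjReverse N q)_{N+1} = Σ_{j ≤ N} q_{j+1} · conj (q_j)` (the `j = N` term vanishes).
Companion of the tree's `LatticeStep.sum_norm_sq_coeff_eq_re_coeff` (the middle coefficient `Σ |q_j|²`).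
[cite: Fejer1916, §1] -/
theorem coeff_succ_mul_conjReverse_self {N : ℕ} {q : ℂ[X]} (hq : q.natDegree ≤ N) :
    (q * conjReverse N q).coeff (N + 1) =
      ∑ j ∈ Finset.range (N + 1), q.coeff (j + 1) * conj (q.coeff j) := by
  rw [coeff_mul, Finset.Nat.sum_antidiagonal_eq_sum_range_succ
    (fun a b => q.coeff a * (conjReverse N q).coeff b) (N + 1), Finset.sum_range_succ']
  have h0 : (conjReverse N q).coeff (N + 1 - 0) = 0 := by
    rw [Nat.sub_zero, coeff_conjReverse', revAt_eq_self_of_lt (Nat.lt_succ_self N),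
      coeff_eq_zero_of_natDegree_lt (Nat.lt_succ_of_le hq), map_zero]
  rw [h0, mul_zero, add_zero]
  refine Finset.sum_congr rfl fun k hk => ?_
  have hkN : k ≤ N := Nat.lt_succ_iff.mp (Finset.mem_range.mp hk)
  rw [show N + 1 - (k + 1) = N - k by omega, coeff_conjReverse q (Nat.sub_le N k),
    Nat.sub_sub_self hkN]

/-- **Fejér's inequality for nonnegative trigonometric polynomials** (Fejér 1915; polynomial form).
If `natDegree p ≤ 2N` and `conj z ^ N · p(z)` is a nonnegative real at every point of the unit circle —
i.e. `T(θ) = e^{-iNθ} p(e^{iθ}) = Σ_{|k| ≤ N} p_{N+k} e^{ikθ}` is a nonnegative trigonometric polynomial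
of degree `N` — then its first coefficient is dominated by `cos(π/(N+2))` times its mean:
`|p_{N+1}| ≤ cos(π/(N+2)) · Re p_N`.  (Kolountzakis–Révész's `M_N = 2cos(π/(N+2))`, display
(cosvalue), in the normalisation `T = 1 + λ cos θ + …`, `λ = 2|p_{N+1}|/p_N`.)  Proof: Fejér–Riesz
`p = q · q*` (tree), `p_N = Σ|q_j|²`, `p_{N+1} = Σ q_{j+1} conj q_j`, and `sum_two_mul_mul_succ_le`.
[cite: Fejer1916, §1] -/
theorem norm_coeff_succ_le_re_coeff_mul_cos {N : ℕ} {p : ℂ[X]} (hdeg : p.natDegree ≤ 2 * N)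
    (hpos : ∀ z : ℂ, ‖z‖ = 1 → 0 ≤ conj z ^ N * p.eval z) :
    ‖p.coeff (N + 1)‖ ≤ (p.coeff N).re * Real.cos (π / (N + 2)) := by
  obtain ⟨q, hq, rfl⟩ := exists_eq_mul_conjReverse N p hdeg hpos
  rw [coeff_succ_mul_conjReverse_self hq, ← sum_norm_sq_coeff_eq_re_coeff q N]
  calc ‖∑ j ∈ Finset.range (N + 1), q.coeff (j + 1) * conj (q.coeff j)‖
      ≤ ∑ j ∈ Finset.range (N + 1), ‖q.coeff (j + 1) * conj (q.coeff j)‖ := norm_sum_le _ _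
    _ = ∑ j ∈ Finset.range N, ‖q.coeff j‖ * ‖q.coeff (j + 1)‖ := by
        rw [Finset.sum_range_succ, coeff_eq_zero_of_natDegree_lt (Nat.lt_succ_of_le hq), zero_mul,
          norm_zero, add_zero]
        refine Finset.sum_congr rfl fun j _ => ?_
        rw [norm_mul, Complex.norm_conj, mul_comm]
    _ ≤ Real.cos (π / (N + 2)) * ∑ j ∈ Finset.range (N + 1), ‖q.coeff j‖ ^ 2 := by
        have h := sum_two_mul_mul_succ_le N (fun j => ‖q.coeff j‖)
        rw [← Finset.mul_sum] at h
        linarith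
    _ = (∑ j ∈ Finset.range (N + 1), ‖q.coeff j‖ ^ 2) * Real.cos (π / (N + 2)) := mul_comm _ _

/-- Fejér's inequality for the coefficient BELOW the middle one: under the same hypotheses and `N ≥ 1`,
`|p_{N-1}| ≤ cos(π/(N+2)) · Re p_N` — `p` is conjugate-reciprocal (`FejerRiesz.conjReverse_eq_self_of_nonneg`),
so `p_{N-1} = conj p_{N+1}`. [cite: Fejer1916, §1] -/
theorem norm_coeff_pred_le_re_coeff_mul_cos {N : ℕ} (hN : 1 ≤ N) {p : ℂ[X]}
    (hdeg : p.natDegree ≤ 2 * N) (hpos : ∀ z : ℂ, ‖z‖ = 1 → 0 ≤ conj z ^ N * p.eval z) :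
    ‖p.coeff (N - 1)‖ ≤ (p.coeff N).re * Real.cos (π / (N + 2)) := by
  have hsym := conjReverse_eq_self_of_nonneg hdeg hpos
  have e : p.coeff (N - 1) = conj (p.coeff (N + 1)) := by
    conv_lhs => rw [← hsym]
    rw [coeff_conjReverse p (show N - 1 ≤ 2 * N by omega), show 2 * N - (N - 1) = N + 1 by omega]
  rw [e, Complex.norm_conj]
  exact norm_coeff_succ_le_re_coeff_mul_cos hdeg hpos

/-- The middle coefficient of a nonnegative trigonometric polynomial (its mean) is a nonnegative real:
`0 ≤ Re p_N` (indeed `p_N = Σ |q_j|²`). [cite: Fejer1916, §1] -/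
theorem re_coeff_nonneg {N : ℕ} {p : ℂ[X]} (hdeg : p.natDegree ≤ 2 * N)
    (hpos : ∀ z : ℂ, ‖z‖ = 1 → 0 ≤ conj z ^ N * p.eval z) : 0 ≤ (p.coeff N).re := by
  obtain ⟨q, _, rfl⟩ := exists_eq_mul_conjReverse N p hdeg hpos
  rw [← sum_norm_sq_coeff_eq_re_coeff q N]
  positivity

/-! ## §2 Boas–Kac, Theorem 2 -/

/-- A continuous function with `tsupport f ⊆ [-s, s]` vanishes wherever `s ≤ |y|` (at `|y| = s` by
continuity: a nonzero value would put a neighbourhood of `y` inside the support). [folklore] -/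
private theorem eq_zero_of_le_abs {f : ℝ → ℂ} (hf : Continuous f) {s : ℝ}
    (hsupp : tsupport f ⊆ Icc (-s) s) {y : ℝ} (hy : s ≤ |y|) : f y = 0 := by
  by_contra h
  have hev : ∀ᶠ z in 𝓝 y, f z ≠ 0 := hf.continuousAt.eventually_ne h
  have hnhds : Icc (-s) s ∈ 𝓝 y :=
    Filter.mem_of_superset hev fun z hz => hsupp (subset_tsupport f hz)
  have hy' : y ∈ interior (Icc (-s) s) := mem_interior_iff_mem_nhds.mpr hnhds
  rw [interior_Icc, mem_Ioo] at hy'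
  have : |y| < s := abs_lt.mpr hy'
  linarith

/-- **Boas–Kac 1945, Theorem 2 (mesh form).**  Let `f : ℝ → ℂ` be smooth with `tsupport f ⊆ [-s, s]`
(`s > 0`) and positive definite (`𝓕 f ξ` a nonnegative real for every `ξ`).  For a mesh `h > 0` put
`n = ⌈s/h⌉₊` (so the lattice points `kh`, `|k| ≥ n`, carry no mass).  Then
`‖f(h)‖ ≤ Re f(0) · cos(π/(n+1))` and `‖f(-h)‖ ≤ Re f(0) · cos(π/(n+1))`.
(Kolountzakis–Révész Cor. 3 "(Boas–Kac)": no multiples `kz`, `k > n-1`, in the support ⇒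
`𝓜 ≤ cos(π/((n-1)+2))`; the sample sequence `(f(kh))_{|k|<n}` is the coefficient sequence of a
nonnegative trigonometric polynomial of degree `n-1` by Poisson summation — the tree's
`BoasKacNonneg.nonneg_conj_pow_mul_eval_samplePoly` — and Fejér's inequality applies.)
[cite: BoasKac1945, Thm 2] [cite: KolountzakisRevesz2006, Cor. 3] -/
theorem norm_apply_mesh_le {f : ℝ → ℂ} (hf : ContDiff ℝ ∞ f) {s : ℝ} (hs : 0 < s)
    (hsupp : tsupport f ⊆ Icc (-s) s) (hpos : ∀ ξ : ℝ, 0 ≤ 𝓕 f ξ) {h : ℝ} (hh : 0 < h) :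
    ‖f h‖ ≤ (f 0).re * Real.cos (π / (⌈s / h⌉₊ + 1)) ∧
      ‖f (-h)‖ ≤ (f 0).re * Real.cos (π / (⌈s / h⌉₊ + 1)) := by
  have hcont : Continuous f := hf.continuous
  have hfc : HasCompactSupport f :=
    IsCompact.of_isClosed_subset isCompact_Icc (isClosed_tsupport f) hsupp
  -- `n = ⌈s/h⌉₊ = m + 1 ≥ 1`
  obtain ⟨m, hm⟩ : ∃ m : ℕ, ⌈s / h⌉₊ = m + 1 :=
    Nat.exists_eq_add_one_of_ne_zero (Nat.pos_iff_ne_zero.mp (Nat.ceil_pos.mpr (div_pos hs hh)))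
  have hms : s ≤ ((m : ℝ) + 1) * h := by
    have h1 := Nat.le_ceil (s / h)
    rw [hm] at h1
    push_cast at h1
    rwa [div_le_iff₀ hh] at h1
  rw [hm]
  push_cast
  rw [show ((m : ℝ) + 1 + 1) = (m : ℝ) + 2 by ring]
  -- the data of the tree's lattice lemma: `a = (m+1)h/2`, samples at `jh - 2a = (j - (m+1))h`
  set a : ℝ := ((m : ℝ) + 1) * h / 2 with ha
  have hn : ((m : ℝ) + 1) * h = 2 * a := by rw [ha]; ring
  have hka : ∀ y : ℝ, 2 * a < |y| → f y = 0 := fun y hy =>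
    eq_zero_of_le_abs hcont hsupp (by linarith)
  set P : ℂ[X] := samplePoly h (2 * m + 1 + 1) (fun y => f (y - 2 * a)) with hP
  have hPpos : ∀ z : ℂ, ‖z‖ = 1 → 0 ≤ conj z ^ (m + 1) * P.eval z := fun z hz =>
    nonneg_conj_pow_mul_eval_samplePoly (a := a) (k := f) hh hf hfc hka hpos m hn hz
  have hPdeg : P.natDegree ≤ 2 * m + 1 + 1 := natDegree_samplePoly_le _ _ _
  have hPcoeff : ∀ j : ℕ, j ≤ 2 * m + 1 + 1 → P.coeff j = f (((j : ℝ) - (m + 1)) * h) := by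
    intro j hj
    rw [hP, coeff_samplePoly_of_le hj]
    congr 1
    rw [← hn]; ring
  -- the extreme samples vanish: `f(±(m+1)h) = 0` since `(m+1)h ≥ s`
  have hP0 : P.coeff 0 = 0 := by
    rw [hPcoeff 0 (Nat.zero_le _)]
    refine eq_zero_of_le_abs hcont hsupp ?_
    rw [show (((0 : ℕ) : ℝ) - (m + 1)) * h = -(((m : ℝ) + 1) * h) by push_cast; ring, abs_neg,
      abs_of_pos (by positivity)]
    exact hms
  have hPtop : P.coeff (2 * m + 1 + 1) = 0 := by
    rw [hPcoeff _ le_rfl]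
    refine eq_zero_of_le_abs hcont hsupp ?_
    rw [show (((2 * m + 1 + 1 : ℕ) : ℝ) - (m + 1)) * h = ((m : ℝ) + 1) * h by push_cast; ring,
      abs_of_pos (by positivity)]
    exact hms
  -- `Q = P / X`: degree `≤ 2m`, same positivity at level `m`
  set Q : ℂ[X] := P.divX with hQ
  have hPQ : P = Q * X := by
    have h1 := divX_mul_X_add P
    rw [hP0, map_zero, add_zero] at h1
    exact h1.symm
  have hQcoeff : ∀ j, Q.coeff j = P.coeff (j + 1) := fun j => coeff_divX
  have hQdeg : Q.natDegree ≤ 2 * m := by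
    refine (natDegree_le_iff_coeff_eq_zero).mpr fun j hj => ?_
    rw [hQcoeff]
    rcases Nat.lt_or_ge (2 * m + 1 + 1) (j + 1) with hlt | hge
    · exact coeff_eq_zero_of_natDegree_lt (hPdeg.trans_lt hlt)
    · rw [show j + 1 = 2 * m + 1 + 1 by omega, hPtop]
  have hQpos : ∀ z : ℂ, ‖z‖ = 1 → 0 ≤ conj z ^ m * Q.eval z := by
    intro z hz
    have h1 := hPpos z hz
    rw [hPQ, eval_mul, eval_X] at h1
    have e : conj z ^ (m + 1) * (Q.eval z * z) = conj z ^ m * Q.eval z * (conj z * z) := by ring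
    rwa [e, conj_mul_of_norm_eq_one hz, mul_one] at h1
  -- the three central samples
  have hmid : Q.coeff m = f 0 := by
    rw [hQcoeff, hPcoeff _ (by omega)]
    congr 1; push_cast; ring
  have hup : Q.coeff (m + 1) = f h := by
    rw [hQcoeff, hPcoeff _ (by omega)]
    congr 1; push_cast; ring
  -- Fejér at level `m`
  have hF := norm_coeff_succ_le_re_coeff_mul_cos hQdeg hQpos
  rw [hup, hmid] at hF
  refine ⟨hF, ?_⟩
  rcases Nat.eq_zero_or_pos m with hm0 | hm1
  · -- `n = 1`: `h ≥ s`, so `f(-h) = 0`, and the bound reads `0 ≤ Re f(0) · cos(π/2) = 0`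
    subst hm0
    have hz : f (-h) = 0 :=
      eq_zero_of_le_abs hcont hsupp (by rw [abs_neg, abs_of_pos hh]; simpa using hms)
    rw [hz, norm_zero, Nat.cast_zero, zero_add, Real.cos_pi_div_two, mul_zero]
  · have hdown : Q.coeff (m - 1) = f (-h) := by
      rw [hQcoeff, hPcoeff _ (by omega)]
      congr 1
      rw [show ((m - 1 + 1 : ℕ) : ℝ) = m by rw [Nat.sub_add_cancel hm1]]
      ring
    have hF' := norm_coeff_pred_le_re_coeff_mul_cos hm1 hQdeg hQpos
    rw [hdown, hmid] at hF'
    exact hF'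

/-- **Boas–Kac 1945, Theorem 2.**  Let `f : ℝ → ℂ` be smooth, positive definite (`𝓕 f ξ ≥ 0` as a
nonnegative real for every `ξ`) with `tsupport f ⊆ [-s, s]`, `s > 0`.  Then for every `x ≠ 0`

  `‖f(x)‖ ≤ Re f(0) · cos (π / (⌈s/|x|⌉₊ + 1))`.

As printed by Boas–Kac (in Connes–Consani's words, Selecta 2021 Rem. 3.9 (i): "the bound given by
Theorem 2 of [BK] — a typo corrected [later] indicates that one should use the ceiling function —
`|f(x)| ≤ f(0) cos(π/(⌈s/x⌉+1))` for any positive definite function `f` with support in `[-s,s]`");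
Kolountzakis–Révész 2006, Cor. 1 (Boas–Kac [BK]): for `s/(n+1) ≤ |x| < s/n` the extremal value is
exactly `cos(π/(n+2))`, `n + 1 = ⌈s/|x|⌉`.  For `|x| ≥ s` both sides vanish (`⌈s/|x|⌉ = 1`,
`cos(π/2) = 0`).
-- TODO(general form): merely continuous positive definite `f` (Bochner's theorem + mollification).
[cite: BoasKac1945, Thm 2] [cite: KolountzakisRevesz2006, Cor. 1] -/
theorem norm_le_re_apply_zero_mul_cos {f : ℝ → ℂ} (hf : ContDiff ℝ ∞ f) {s : ℝ} (hs : 0 < s)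
    (hsupp : tsupport f ⊆ Icc (-s) s) (hpos : ∀ ξ : ℝ, 0 ≤ 𝓕 f ξ) {x : ℝ} (hx : x ≠ 0) :
    ‖f x‖ ≤ (f 0).re * Real.cos (π / (⌈s / |x|⌉₊ + 1)) := by
  have h := norm_apply_mesh_le hf hs hsupp hpos (abs_pos.mpr hx)
  rcases lt_or_gt_of_ne hx with hlt | hgt
  · have e : f x = f (-|x|) := by rw [abs_of_neg hlt, neg_neg]
    rw [e]
    exact h.2
  · have e : f x = f |x| := by rw [abs_of_pos hgt]
    rw [e]
    exact h.1

/-- Under the hypotheses of Boas–Kac's theorem `0 ≤ Re f(0)` (from the bound at mesh `s/2`: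
`0 ≤ ‖f(s/2)‖ ≤ Re f(0) · cos(π/3)`). [cite: BoasKac1945, Thm 2] -/
theorem re_apply_zero_nonneg {f : ℝ → ℂ} (hf : ContDiff ℝ ∞ f) {s : ℝ} (hs : 0 < s)
    (hsupp : tsupport f ⊆ Icc (-s) s) (hpos : ∀ ξ : ℝ, 0 ≤ 𝓕 f ξ) : 0 ≤ (f 0).re := by
  -- at mesh `h = s`: `‖f s‖ ≤ Re f(0) · cos(π/2)` is useless, but the bound at `h = s/2`,
  -- `0 ≤ ‖f(s/2)‖ ≤ Re f(0) · cos(π/3) = Re f(0)/2`, forces `Re f(0) ≥ 0`.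
  have h := (norm_apply_mesh_le hf hs hsupp hpos (half_pos hs)).1
  have hc : ⌈s / (s / 2)⌉₊ = 2 := by
    have e : s / (s / 2) = ((2 : ℕ) : ℝ) := by
      rw [div_eq_iff (ne_of_gt (half_pos hs))]
      push_cast
      ring
    rw [e, Nat.ceil_natCast]
  rw [hc] at h
  have hcos : Real.cos (π / ((2 : ℕ) + 1)) = 1 / 2 := by
    rw [show (π / ((2 : ℕ) + 1) : ℝ) = π / 3 by norm_num, Real.cos_pi_div_three]
  rw [hcos] at h
  nlinarith [norm_nonneg (f (s / 2))]

end Literature.Analysis.Fourier.BoasKacPointwise
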